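import Mathlib
import Summits.NavierStokesRegularity.NavierStokesRegularity.Theorems.EulerZoomLiouvillePowerGaugeEulerLiouvilleHoopAxisChart
import Summits.NavierStokesRegularity.NavierStokesRegularity.Theorems.EulerZoomLiouvillePowerGaugeEulerLiouvilleHoopAxisEndTerm

/-!
# Hoop core — AX-3: the axis law at a fixed height (general centre), and `HoopCore.AxisLaw γ`

Sub-problem `NavierStokesRegularity`, crux `PowerGaugeEulerLiouville` (a crux CLASS of self-similar Euler/NS strata on the
MODEL lattice — not NS regularity, not E).  K-AXIS plate AX-3 (LEAD 19832 ns-typeII-p2 g14; seat ns-ezl-w3 g7).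

The `t`-integration of the circle-averaged radial law (AX-2, `…HoopAxisRadialLaw.radialLaw_circleAvg`, in the split chart form
`…HoopAxisChart.radialLaw_chart`) from the axis `t = 0` to `t = T₀`, in ONE application of Mathlib's FTC for improper endpoints
`intervalIntegral.integral_eq_sub_of_hasDerivAt_of_tendsto` on `(0, T₀)` to `f(t) = ⟨P⟩(σ,t) + ⟨(γr + V_r)V_r⟩(σ,t)` (chart form):
the right-hand limit of `f` at `0` is `P(σe_z) + ½(‖V(σe_z)‖² − V_z(σe_z)²)` (the AXIS ATOM, `…HoopAxisAtom`), the derivative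
`−φ(t) = −[∂_σ⟨(γ(y₂−c₂)+V_z)V_r⟩ − γ∂_σ⟨−(c₀ê_r⁰+c₁ê_r¹)V_z⟩ + (1−3γ)⟨V_r⟩ + ⟨V_r²−V_θ²⟩/t]` is interval integrable on `[0, T₀]`
(`…HoopAxisAtom.intervalIntegrable_circleAvg_hoop_div`), and `∫₀^{T₀}` of the two `∂_σ`-terms are `deriv endTermC`, `deriv offsetTerm`
(`…HoopAxisEndTerm`).  Results:

* `axisLaw_fixed` — for `IsSelfSimilarEulerProfile γ c V P`, every `σ` and `T₀ > 0`:
  `P(σe_z) − ⟨P⟩(σ,T₀) = ∫₀^{T₀}⟨V_r²−V_θ²⟩dt/t − ½(‖V(σe_z)‖² − V_z(σe_z)²) + (1−3γ)∫₀^{T₀}⟨V_r⟩dt + ⟨(γr+V_r)V_r⟩(σ,T₀)`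
  `+ deriv (endTermC γ c V T₀) σ − deriv (offsetTerm γ c V T₀) σ`;
* `axisLaw : AxisLaw γ` — the typed target `HoopCore.AxisLaw` of `…HoopDefs` (centre `0`: `endTermC γ 0 = endTerm γ`, `offsetTerm γ 0 = 0`).

WHAT THIS IS NOT: not NS, not E — an identity for hypothetical profiles; 19832 OPEN; NS regularity NOT proved.
[folklore (the profile equation tested against `∇_⊥ log t`; ns-idea-11 g8 HOOP NOTE §2)]
-/

noncomputable section

open MeasureTheory Set WithLp Metric Real Function Filter Topology intervalIntegral
open scoped InnerProductSpace RealInnerProductSpace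

set_option linter.dupNamespace false

namespace Summit.NavierStokesRegularity.NavierStokesRegularity.Theorems.PowerGaugeEulerLiouville.HoopCore

open Literature.Analysis Literature.Analysis.FluidPDE

variable {V : EuclideanSpace ℝ (Fin 3) → EuclideanSpace ℝ (Fin 3)}

/-! ## §1 Chart forms of the two `t`-integrals of the law -/

/-- **Chart form of the hoop term**: `∫₀^{T₀} ⟨V_r² − V_θ²⟩(s,t)/t dt = ∫₀^{T₀} [(2π)⁻¹∫₀^{2π}(A² − B²)dθ]/t dt` (`T₀ ≥ 0`; the integrands
agree on `(0, T₀]`). [folklore] -/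
theorem intervalIntegral_circleAvg_hoop_div_eq_chart (V : EuclideanSpace ℝ (Fin 3) → EuclideanSpace ℝ (Fin 3)) (s : ℝ)
    {T₀ : ℝ} (hT₀ : 0 ≤ T₀) :
    ∫ t in (0 : ℝ)..T₀, circleAvg (fun y => radialVelocity V y ^ 2 - swirlVelocity V y ^ 2) s t / t =
      ∫ t in (0 : ℝ)..T₀, (1 / (2 * Real.pi) * ∫ θ in (0 : ℝ)..2 * Real.pi,
        (⟪V (axisPt s t θ), rotZ θ (EuclideanSpace.single (0 : Fin 3) (1 : ℝ))⟫ ^ 2 -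
          ⟪V (axisPt s t θ), rotZ θ (EuclideanSpace.single (1 : Fin 3) (1 : ℝ))⟫ ^ 2)) / t := by
  refine intervalIntegral.integral_congr_ae (Filter.Eventually.of_forall fun t ht => ?_)
  rw [uIoc_of_le hT₀] at ht
  rw [circleAvg_hoop_eq_chart V s ht.1]

/-- **Chart form of the `(1 − 3γ)`-term**: `∫₀^{T₀} ⟨V_r⟩(s,t) dt = ∫₀^{T₀} (2π)⁻¹∫₀^{2π} A dθ dt` (`T₀ ≥ 0`). [folklore] -/
theorem intervalIntegral_circleAvg_radialVelocity_eq_chart (V : EuclideanSpace ℝ (Fin 3) → EuclideanSpace ℝ (Fin 3))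
    (s : ℝ) {T₀ : ℝ} (hT₀ : 0 ≤ T₀) :
    ∫ t in (0 : ℝ)..T₀, circleAvg (radialVelocity V) s t =
      ∫ t in (0 : ℝ)..T₀, 1 / (2 * Real.pi) * ∫ θ in (0 : ℝ)..2 * Real.pi,
        ⟪V (axisPt s t θ), rotZ θ (EuclideanSpace.single (0 : Fin 3) (1 : ℝ))⟫ := by
  refine intervalIntegral.integral_congr_ae (Filter.Eventually.of_forall fun t ht => ?_)
  rw [uIoc_of_le hT₀] at ht
  rw [circleAvg_radialVelocity_eq_chart V s ht.1]

/-- The chart hoop quotient `[(2π)⁻¹∫₀^{2π}(A² − B²)dθ]/t` is interval integrable on `[0, T₀]` (`V ∈ C¹`, `T₀ ≥ 0`). [folklore] -/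
theorem intervalIntegrable_chartAvg_hoop_div (hV : ContDiff ℝ 1 V) (s : ℝ) {T₀ : ℝ} (hT₀ : 0 ≤ T₀) :
    IntervalIntegrable (fun t : ℝ => (1 / (2 * Real.pi) * ∫ θ in (0 : ℝ)..2 * Real.pi,
        (⟪V (axisPt s t θ), rotZ θ (EuclideanSpace.single (0 : Fin 3) (1 : ℝ))⟫ ^ 2 -
          ⟪V (axisPt s t θ), rotZ θ (EuclideanSpace.single (1 : Fin 3) (1 : ℝ))⟫ ^ 2)) / t) volume 0 T₀ := by
  refine (intervalIntegrable_circleAvg_hoop_div hV s hT₀).congr fun t ht => ?_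
  rw [uIoc_of_le hT₀] at ht
  simp only [circleAvg_hoop_eq_chart V s ht.1]

/-! ## §2 AX-3: the axis law at a fixed height, general centre -/

/-- **AX-3 — THE AXIS LAW AT A FIXED HEIGHT, GENERAL CENTRE `c`.**  For a `C²` self-similar Euler profile pair
`IsSelfSimilarEulerProfile γ c V P` (`(1−γ)V + DV[γ(y−c) + V] + ∇P = 0`, `div V = 0`), every height `σ` and every `T₀ > 0`:
`P(σe_z) − ⟨P⟩_θ(σ,T₀) = ∫₀^{T₀}⟨V_r² − V_θ²⟩_θ dt/t − ½(‖V(σe_z)‖² − V_z(σe_z)²) + (1−3γ)∫₀^{T₀}⟨V_r⟩_θ dt + ⟨(γr + V_r)V_r⟩_θ(σ,T₀)`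
`+ (endTermC γ c V T₀)′(σ) − (offsetTerm γ c V T₀)′(σ)`.
Proof: FTC with improper endpoints on `(0, T₀)` for `t ↦ ⟨P⟩(σ,t) + ⟨(γr+V_r)V_r⟩(σ,t)` (derivative from AX-2 in chart form, right
limit at `0` = `P(σe_z)` + the axis atom), then the end-term derivatives of `…HoopAxisEndTerm`. [folklore] -/
theorem axisLaw_fixed {γ : ℝ} {c : EuclideanSpace ℝ (Fin 3)} {P : EuclideanSpace ℝ (Fin 3) → ℝ}
    (hprof : IsSelfSimilarEulerProfile γ c V P) (σ : ℝ) {T₀ : ℝ} (hT₀ : 0 < T₀) :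
    P (σ • eZ) - circleAvg P σ T₀ =
      (∫ t in (0 : ℝ)..T₀, circleAvg (fun y => radialVelocity V y ^ 2 - swirlVelocity V y ^ 2) σ t / t)
        - 1 / 2 * (‖V (σ • eZ)‖ ^ 2 - axialVelocity V (σ • eZ) ^ 2)
        + (1 - 3 * γ) * (∫ t in (0 : ℝ)..T₀, circleAvg (radialVelocity V) σ t)
        + circleAvg (fun y => (γ * cylRadius y + radialVelocity V y) * radialVelocity V y) σ T₀
        + deriv (endTermC γ c V T₀) σ - deriv (offsetTerm γ c V T₀) σ := by
  have hV1 : ContDiff ℝ 1 V := hprof.contDiff_velocity.of_le (by norm_num)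
  have hVc : Continuous V := hprof.contDiff_velocity.continuous
  have hP1 : ContDiff ℝ 1 P := hprof.contDiff_pressure
  have hPc : Continuous P := hP1.continuous
  -- the chart functions of `t` at the fixed height `σ` (opaque names with defining equations)
  obtain ⟨W, hW⟩ : ∃ W : ℝ → ℝ, W = fun t : ℝ => 1 / (2 * Real.pi) * ∫ θ in (0 : ℝ)..2 * Real.pi,
      (γ * t + ⟪V (axisPt σ t θ), rotZ θ (EuclideanSpace.single (0 : Fin 3) (1 : ℝ))⟫) *
        ⟪V (axisPt σ t θ), rotZ θ (EuclideanSpace.single (0 : Fin 3) (1 : ℝ))⟫ := ⟨_, rfl⟩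
  obtain ⟨Es, hEs⟩ : ∃ Es : ℝ → ℝ, Es = fun t : ℝ => 1 / (2 * Real.pi) * ∫ θ in (0 : ℝ)..2 * Real.pi,
      ((γ + ⟪fderiv ℝ V (axisPt σ t θ) eZ, eZ⟫) * ⟪V (axisPt σ t θ), rotZ θ (EuclideanSpace.single (0 : Fin 3) (1 : ℝ))⟫ +
        (γ * (σ - c 2) + axialVelocity V (axisPt σ t θ)) *
          ⟪fderiv ℝ V (axisPt σ t θ) eZ, rotZ θ (EuclideanSpace.single (0 : Fin 3) (1 : ℝ))⟫) := ⟨_, rfl⟩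
  obtain ⟨Os, hOs⟩ : ∃ Os : ℝ → ℝ, Os = fun t : ℝ => 1 / (2 * Real.pi) * ∫ θ in (0 : ℝ)..2 * Real.pi,
      (-(c 0 * Real.cos θ + c 1 * Real.sin θ)) * ⟪fderiv ℝ V (axisPt σ t θ) eZ, eZ⟫ := ⟨_, rfl⟩
  obtain ⟨Ac, hAc⟩ : ∃ Ac : ℝ → ℝ, Ac = fun t : ℝ => 1 / (2 * Real.pi) * ∫ θ in (0 : ℝ)..2 * Real.pi,
      ⟪V (axisPt σ t θ), rotZ θ (EuclideanSpace.single (0 : Fin 3) (1 : ℝ))⟫ := ⟨_, rfl⟩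
  obtain ⟨Hc, hHc⟩ : ∃ Hc : ℝ → ℝ, Hc = fun t : ℝ => 1 / (2 * Real.pi) * ∫ θ in (0 : ℝ)..2 * Real.pi,
      (⟪V (axisPt σ t θ), rotZ θ (EuclideanSpace.single (0 : Fin 3) (1 : ℝ))⟫ ^ 2 -
        ⟪V (axisPt σ t θ), rotZ θ (EuclideanSpace.single (1 : Fin 3) (1 : ℝ))⟫ ^ 2) := ⟨_, rfl⟩
  -- Step 1: the derivative of `⟨P⟩ + W` on `(0, T₀)` (AX-2 in chart form)
  have hderiv : ∀ t ∈ Ioo 0 T₀, HasDerivAt (fun t => circleAvg P σ t + W t)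
      (-(Es t - γ * Os t + (1 - 3 * γ) * Ac t + Hc t / t)) t := by
    intro t ht
    have hpd := hasDerivAt_circleAvg_pressure_radius hP1 σ ht.1
    have hWd : HasDerivAt W (1 / (2 * Real.pi) * ∫ θ in (0 : ℝ)..2 * Real.pi,
        (γ * ⟪V (axisPt σ t θ), rotZ θ (EuclideanSpace.single (0 : Fin 3) (1 : ℝ))⟫ +
          (γ * t + 2 * ⟪V (axisPt σ t θ), rotZ θ (EuclideanSpace.single (0 : Fin 3) (1 : ℝ))⟫) *
            ⟪fderiv ℝ V (axisPt σ t θ) (rotZ θ (EuclideanSpace.single (0 : Fin 3) (1 : ℝ))), rotZ θ (EuclideanSpace.single (0 : Fin 3) (1 : ℝ))⟫)) t := by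
      rw [hW]; exact hasDerivAt_chartAvg_lateral hV1 γ σ t
    have hlaw := radialLaw_chart hprof σ ht.1
    refine (hpd.add hWd).congr_deriv ?_
    simp only [hEs, hOs, hAc, hHc]
    linear_combination hlaw
  -- Step 2: continuity of the chart pieces; interval integrability of the derivative
  have hWc : Continuous W := by rw [hW]; exact continuous_chartAvg_lateral hV1 γ σ
  have hEc : Continuous Es := by
    rw [hEs]; exact continuous_of_uncurry_left (continuous_chartAvg_endC_deriv hV1 γ c) σ
  have hOc : Continuous Os := by
    rw [hOs]; exact continuous_of_uncurry_left (continuous_chartAvg_offset_deriv hV1 c) σ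
  have hAcc : Continuous Ac := by rw [hAc]; exact continuous_chartAvg_radialVelocity hVc σ
  have iH : IntervalIntegrable (fun t => Hc t / t) volume 0 T₀ := by
    rw [hHc]; exact intervalIntegrable_chartAvg_hoop_div hV1 σ hT₀.le
  have iE : IntervalIntegrable Es volume 0 T₀ := hEc.intervalIntegrable _ _
  have iO : IntervalIntegrable (fun t => γ * Os t) volume 0 T₀ := (continuous_const.mul hOc).intervalIntegrable _ _
  have iA : IntervalIntegrable (fun t => (1 - 3 * γ) * Ac t) volume 0 T₀ := (continuous_const.mul hAcc).intervalIntegrable _ _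
  have hint : IntervalIntegrable (fun t => -(Es t - γ * Os t + (1 - 3 * γ) * Ac t + Hc t / t)) volume 0 T₀ :=
    (((iE.sub iO).add iA).add iH).neg
  -- Step 3: the one-sided limits of `⟨P⟩ + W`
  have ha : Tendsto (fun t => circleAvg P σ t + W t) (𝓝[>] 0)
      (𝓝 (P (σ • eZ) + 1 / 2 * (‖V (σ • eZ)‖ ^ 2 - axialVelocity V (σ • eZ) ^ 2))) := by
    have hW0 : W 0 = 1 / 2 * (‖V (σ • eZ)‖ ^ 2 - axialVelocity V (σ • eZ) ^ 2) := by
      rw [hW]; exact chartAvg_lateral_zero V γ σ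
    have hWlim := hWc.tendsto 0
    rw [hW0] at hWlim
    exact (tendsto_circleAvg_radius_zero hPc σ).add (tendsto_nhdsWithin_of_tendsto_nhds hWlim)
  have hb : Tendsto (fun t => circleAvg P σ t + W t) (𝓝[<] T₀) (𝓝 (circleAvg P σ T₀ + W T₀)) :=
    tendsto_nhdsWithin_of_tendsto_nhds (((continuous_circleAvg_radius hPc σ).add hWc).tendsto T₀)
  -- Step 4: FTC with improper endpoints on `(0, T₀)`
  have key := intervalIntegral.integral_eq_sub_of_hasDerivAt_of_tendsto hT₀ hderiv hint ha hb
  rw [intervalIntegral.integral_neg, intervalIntegral.integral_add ((iE.sub iO).add iA) iH,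
    intervalIntegral.integral_add (iE.sub iO) iA, intervalIntegral.integral_sub iE iO, intervalIntegral.integral_const_mul,
    intervalIntegral.integral_const_mul] at key
  -- Step 5: identify every piece
  have hE : ∫ t in (0 : ℝ)..T₀, Es t = deriv (endTermC γ c V T₀) σ := by
    rw [hEs, deriv_endTermC hV1 γ c hT₀.le σ]
  have hO : γ * (∫ t in (0 : ℝ)..T₀, Os t) = deriv (offsetTerm γ c V T₀) σ := by
    rw [hOs, deriv_offsetTerm hV1 γ c hT₀.le σ]
  have hA : ∫ t in (0 : ℝ)..T₀, Ac t = ∫ t in (0 : ℝ)..T₀, circleAvg (radialVelocity V) σ t := by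
    rw [hAc, intervalIntegral_circleAvg_radialVelocity_eq_chart V σ hT₀.le]
  have hH : ∫ t in (0 : ℝ)..T₀, Hc t / t =
      ∫ t in (0 : ℝ)..T₀, circleAvg (fun y => radialVelocity V y ^ 2 - swirlVelocity V y ^ 2) σ t / t := by
    rw [hHc, intervalIntegral_circleAvg_hoop_div_eq_chart V σ hT₀.le]
  have hWT : W T₀ = circleAvg (fun y => (γ * cylRadius y + radialVelocity V y) * radialVelocity V y) σ T₀ := by
    rw [hW, circleAvg_lateral_eq_chart V γ σ hT₀]
  rw [hE, hO, hA, hH, hWT] at key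
  linear_combination key

/-! ## §3 The typed target `HoopCore.AxisLaw` -/

/-- **THE AXIS LAW `HoopCore.AxisLaw γ`** (`…HoopDefs`, HOOP-NOTE §2; T-K″): for every `C²` self-similar Euler profile pair with
centre `0` about the radial `x₂`-axis, every `s` and every `T₀ > 0`,
`P(se_z) − ⟨P⟩_θ(s,T₀) = ∫₀^{T₀}⟨V_r² − V_θ²⟩_θ dt/t − ½‖V_⊥(se_z)‖² + (1−3γ)∫₀^{T₀}⟨V_r⟩_θ dt + ⟨(γt + V_r)V_r⟩_θ(s,T₀) + E′(s)`.
The centre-`0` case of `axisLaw_fixed` (`endTermC γ 0 = endTerm γ`, `offsetTerm γ 0 = 0`). [folklore] -/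
theorem axisLaw (γ : ℝ) : AxisLaw γ := by
  intro V P hprof s T₀ hT₀
  have h := axisLaw_fixed hprof s hT₀
  rw [endTermC_zero, deriv_offsetTerm_zero, sub_zero] at h
  exact h

end Summit.NavierStokesRegularity.NavierStokesRegularity.Theorems.PowerGaugeEulerLiouville.HoopCore

end
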